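import Summits.NavierStokesRegularity.FluidComputer.LerayClock
import Literature.Analysis.FluidPDE.OneComponentGradientCriterionProofs
import Literature.Analysis.FluidPDE.CheskidovShvydkoyAssembly
import HarnessLib

/-!
# Fluid computer — the level dictionary, ANISOTROPY FACE (L45): no single velocity component and no single
# direction of differentiation stays tame (one-component / one-direction criteria)

HONEST FRAMING (cell `pub-fluidc`, verbatim): *low prior, high value-of-information experiment on Tao's
machine paradigm; NOT a claim that NS blows up.* Theorem side of the cell; nothing here is evidence of blow-up.
The Serrin, BKM and strain faces (L30, L31, L41) bound ISOTROPIC quantities. The anisotropic criteria of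
Neustupa–Novotný–Penel / Zhou–Pokorný (one velocity COMPONENT) and Kukavica–Ziane (one DIRECTION of
differentiation), in Lemarié-Rieusset's continuation form (2016, Props. 11.5–11.6), are PROVED in the tree on
Tao's `H¹` patches (`limsup_eH1NormSq_lt_top_of_oneComponent`, `exists_lsix_le_of_oneDirection` with
`limsup_eH1NormSq_lt_top_of_ltheta_bound_near`) together with Leray's `H¹` continuation
(`leray_continuation_H1_holds`); their rapid-decay binder is not used. Closed here against the enstrophy clock
L19 (`not_isH1RegularOn_Ioc`: a maximal smooth Leray–Hopf solution is never `H¹`-regular up to its lifespan).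
For every maximal smooth solution `(u, p)` of the unforced Navier–Stokes system on `ℝ³ × [0, T)` (`ν > 0`),
Leray–Hopf from `u 0`, in the coordinates of `EuclideanSpace ℝ (Fin 3)` (third component `u₃ = (u t ·) 2`, third
direction `e₃ = EuclideanSpace.single 2 1`; any fixed component / direction by the symmetry of the equations):

* `not_isH1RegularOn_Ioc` (tool): `¬ IsH1RegularOn (0, T] u`;
* `not_memLqLp_grad_component(_window)` (**L45 — ONE COMPONENT**): `∇u₃ ∉ L^q(t₀, T; L^r)` for every
  `2 ≤ q < ∞`, `2/q + 3/r = 3/2` and every `t₀ ∈ [0, T)` — `∫_{t₀}^{T} ‖∇u₃‖_{L^r}^q dt = ∞`;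
* `not_memLqLp_deriv_direction(_window)` (**L45′ — ONE DIRECTION**): `∂₃u ∉ L^q(t₀, T; L^r)` for every
  `2 ≤ q ≤ 3`, `2/q + 3/r = 2`, `t₀ ∈ [0, T)`;
* `anisotropy_face`: both assembled.

Reading for the machine paradigm (words): a blow-up cannot be 'two-and-a-half-dimensional' — no velocity
component can stay in a Serrin-scaled gradient class and no direction of differentiation can stay tame on a
terminal window; a machine whose design keeps one component (e.g. the axial velocity of a tube array) or one
direction (e.g. the spanwise derivative of a sheet) under control does not blow up. Constants absent (class
statements); window versions by restart at an a.e.-good time (`MemLqLp.translate`). Necessity only. 0 sorry; no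
new definitions, no named facts.

## References

* P. G. Lemarié-Rieusset, *The Navier–Stokes Problem in the 21st Century*, CRC 2016, §11.5, Props. 11.5–11.6.
  [LemarieRieusset2016]
* J. Neustupa, A. Novotný, P. Penel, Topics in mathematical fluid mechanics, Quad. Mat. 10 (2002) 163–183.
  [NeustupaNovotnyPenel2002]
* I. Kukavica, M. Ziane, J. Math. Phys. 48 (2007) 065203. [KukavicaZiane2007]
* J. C. Robinson, J. L. Rodrigo, W. Sadowski, CUP 2016, Lemma 6.11, Lemma 8.16. [RobinsonRodrigoSadowski2016]
-/

noncomputable section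

open MeasureTheory Set Function Filter Topology Metric InnerProductSpace
open scoped ENNReal NNReal RealInnerProductSpace
open Literature.Analysis.FluidPDE Literature.Analysis.FunctionSpaces
open Literature.Analysis.FluidPDE.LPBounds (gradSq)
open Summit.NavierStokesRegularity.FluidComputer.LerayClock
open Summit.NavierStokesRegularity.FluidComputer.BlockEnergyTransport

namespace Summit.NavierStokesRegularity.FluidComputer.AnisotropyFace

/-! ## Tool: a maximal solution is not `H¹`-regular up to its lifespan -/

/-- **A maximal smooth Leray–Hopf solution is never `H¹`-regular on `(0, T]`.** Were `t ↦ ‖u(t)‖²_{H¹}`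
finite and continuous on `(0, T]`, it would be bounded by some `A < ∞` on `[T/2, T]`, so `Z(t) = ∫|∇u(t)|² ≤ A`
there (`gradSq_eq_eWeakGradL2Sq`); but the enstrophy clock L19 (`LerayClock.enstrophy_clock_toReal`) demands
`c₁ν³ ≤ Z(t)²(T − t)` — impossible for `t` close to `T`. This is the common last step of every `H¹`-continuation
criterion read on the class. [cite: RobinsonRodrigoSadowski2016, Lemma 6.11 and Lemma 8.16] -/
theorem not_isH1RegularOn_Ioc {ν T : ℝ} (hν : 0 < ν) (hT : 0 < T)
    {u : ℝ → EuclideanSpace ℝ (Fin 3) → EuclideanSpace ℝ (Fin 3)} {p : ℝ → EuclideanSpace ℝ (Fin 3) → ℝ}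
    (hmax : IsMaximalSmoothSolution ν 0 u p T) (hLH : IsLerayHopfOn T ν 0 (u 0) u) :
    ¬ IsH1RegularOn (Ioc 0 T) u := by
  intro hregT
  have hreg : IsH1RegularOn (Icc (T / 2) T) u := hregT.mono fun t ht => ⟨by linarith [ht.1], ht.2⟩
  obtain ⟨A, hAtop, hAle⟩ := hreg.exists_forall_le isCompact_Icc subset_rfl
  obtain ⟨c₁, hc₁, H⟩ := enstrophy_clock_toReal
  set a : ℝ := A.toReal with ha
  have ha0 : 0 ≤ a := ENNReal.toReal_nonneg
  have hcν : 0 < c₁ * ν ^ 3 := mul_pos hc₁ (pow_pos hν 3)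
  have ha1 : 0 < a ^ 2 + 1 := by positivity
  set t : ℝ := max (T / 2) (T - c₁ * ν ^ 3 / (2 * (a ^ 2 + 1))) with htdef
  have hδ : 0 < c₁ * ν ^ 3 / (2 * (a ^ 2 + 1)) := by positivity
  have ht2 : T / 2 ≤ t := le_max_left _ _
  have htT : t < T := max_lt (by linarith) (by linarith)
  have ht0 : 0 < t := by linarith
  have hTt : T - t ≤ c₁ * ν ^ 3 / (2 * (a ^ 2 + 1)) := by
    have := le_max_right (T / 2) (T - c₁ * ν ^ 3 / (2 * (a ^ 2 + 1)))
    linarith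
  have hclock := H ν T hν hT u p hmax hLH t ⟨ht0, htT⟩
  obtain ⟨hZ, -⟩ := lintegral_frobeniusNormSq_eq_gradSq hν hT hmax hLH ⟨ht0, htT⟩
  have hsm : IsSmoothL2Field (u t) := isSmoothL2Field_slice_of_maximal hν hT hmax hLH ⟨ht0, htT⟩
  have hZle : (∫⁻ x, ENNReal.ofReal (frobeniusNormSq (fderiv ℝ (u t) x))).toReal ≤ a := by
    rw [hZ, gradSq_eq_eWeakGradL2Sq hsm, ha]
    refine ENNReal.toReal_mono hAtop.ne ?_
    calc eWeakGradL2Sq (u t) ≤ eH1NormSq (u t) := le_add_self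
      _ ≤ A := hAle t ⟨ht2, htT.le⟩
  have hZnn : 0 ≤ (∫⁻ x, ENNReal.ofReal (frobeniusNormSq (fderiv ℝ (u t) x))).toReal := ENNReal.toReal_nonneg
  have h1 : (∫⁻ x, ENNReal.ofReal (frobeniusNormSq (fderiv ℝ (u t) x))).toReal ^ 2 * (T - t) ≤
      a ^ 2 * (c₁ * ν ^ 3 / (2 * (a ^ 2 + 1))) :=
    mul_le_mul (pow_le_pow_left₀ hZnn hZle 2) hTt (by linarith) (sq_nonneg a)
  have h2 : a ^ 2 * (c₁ * ν ^ 3 / (2 * (a ^ 2 + 1))) < c₁ * ν ^ 3 := by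
    rw [← mul_div_assoc, div_lt_iff₀ (by positivity)]
    nlinarith [sq_nonneg a]
  linarith

/-! ## L45: one component -/

/-- **L45 — NO VELOCITY COMPONENT STAYS TAME (one-component gradient criterion on the class).** For `ν > 0`,
`T > 0`, every maximal smooth solution `(u, p)` of the unforced Navier–Stokes system on `ℝ³ × [0, T)` which is
Leray–Hopf from `u 0`, and all `2 ≤ q < ∞`, `2/q + 3/r = 3/2`: `∇u₃ ∉ L^q(0, T; L^r(ℝ³))`, `u₃` the third
component. Proof: the tree's one-component bound on Tao patches (`limsup_eH1NormSq_lt_top_of_oneComponent`) and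
Leray's continuation would make `u` `H¹`-regular on `(0, T]`, against `not_isH1RegularOn_Ioc`.
[cite: LemarieRieusset2016, Prop. 11.5 (PDF p. 354)] [cite: NeustupaNovotnyPenel2002, Thm 1] -/
theorem not_memLqLp_grad_component {ν T : ℝ} (hν : 0 < ν) (hT : 0 < T)
    {u : ℝ → EuclideanSpace ℝ (Fin 3) → EuclideanSpace ℝ (Fin 3)} {p : ℝ → EuclideanSpace ℝ (Fin 3) → ℝ}
    (hmax : IsMaximalSmoothSolution ν 0 u p T) (hLH : IsLerayHopfOn T ν 0 (u 0) u)
    {q r : ℝ≥0∞} (h2q : 2 ≤ q) (hqtop : q < ⊤) (hqr : 2 / q + 3 / r = 3 / 2) :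
    ¬ MemLqLp q r (fun t x => fderiv ℝ (fun y => u t y 2) x) (Ioo 0 T) := by
  intro hS
  obtain ⟨c, hc, hL2⟩ := tao2011_H1_local_almost_regular_holds
  obtain ⟨hr0, hrtop, hr2, hr6, hq0, hqtop', hqR⟩ := oneComponent_exponents h2q hqtop hqr
  obtain ⟨hA, hLr⟩ := oneComponent_weight_ne_top hLH hmax.1 hq0 hqtop' hr0 hrtop hS
  rw [hqR] at hA
  exact not_isH1RegularOn_Ioc hν hT hmax hLH
    (leray_continuation_H1_holds ν T hν hT (u 0) u hLH fun α β hα hαβ hβ hregI =>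
      limsup_eH1NormSq_lt_top_of_oneComponent hL2 hc hν hLH hmax.1 hr2 hr6 hLr hA hα hαβ hβ hregI)

/-- **L45 ON EVERY TERMINAL WINDOW**: for every `t₀ ∈ [0, T)`, `∇u₃ ∉ L^q(t₀, T; L^r)` — i.e.
`∫_{t₀}^{T} ‖∇u₃‖_{L^r}^q dt = ∞` on every terminal window (restart at an a.e.-good time `s ∈ (t₀, T)`; the
translate is a maximal smooth Leray–Hopf solution, `MemLqLp.translate`).
[cite: LemarieRieusset2016, Prop. 11.5 (PDF p. 354)] -/
theorem not_memLqLp_grad_component_window {ν T : ℝ} (hν : 0 < ν)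
    {u : ℝ → EuclideanSpace ℝ (Fin 3) → EuclideanSpace ℝ (Fin 3)} {p : ℝ → EuclideanSpace ℝ (Fin 3) → ℝ}
    (hmax : IsMaximalSmoothSolution ν 0 u p T) (hLH : IsLerayHopfOn T ν 0 (u 0) u)
    {q r : ℝ≥0∞} (h2q : 2 ≤ q) (hqtop : q < ⊤) (hqr : 2 / q + 3 / r = 3 / 2)
    {t₀ : ℝ} (ht₀ : t₀ ∈ Ico 0 T) :
    ¬ MemLqLp q r (fun t x => fderiv ℝ (fun y => u t y 2) x) (Ioo t₀ T) := by
  intro hS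
  obtain ⟨s, hs, hLHs⟩ := hLH.exists_isLerayHopfOn_restart_Ioo hν.le ht₀.1 ht₀.2 le_rfl
  have hs0 : 0 < s := ht₀.1.trans_lt hs.1
  have hTs : 0 < T - s := sub_pos.2 hs.2
  have hmax' : IsMaximalSmoothSolution ν 0 (fun t => u (t + s)) (fun t => p (t + s)) (T - s) :=
    hmax.translate_zero hs0 hs.2
  have hLH' : IsLerayHopfOn (T - s) ν 0 ((fun t => u (t + s)) 0) (fun t => u (t + s)) := by
    show IsLerayHopfOn (T - s) ν 0 (u (0 + s)) (fun t => u (t + s))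
    rw [zero_add]
    exact hLHs
  have hS' : MemLqLp q r (fun t x => fderiv ℝ (fun y => u (t + s) y 2) x) (Ioo 0 (T - s)) := by
    have h := hS.mono_set (Ioo_subset_Ioo hs.1.le le_rfl)
    rw [show Ioo s T = Ioo (0 + s) (T - s + s) by rw [zero_add, sub_add_cancel]] at h
    exact h.translate s
  exact not_memLqLp_grad_component hν hTs hmax' hLH' h2q hqtop hqr hS'

/-! ## L45′: one direction -/

/-- **L45′ — NO DIRECTION OF DIFFERENTIATION STAYS TAME (one-direction derivative criterion on the class).** With
the same data and all `2 ≤ q ≤ 3`, `2/q + 3/r = 2`: `∂₃u ∉ L^q(0, T; L^r(ℝ³))`, `∂₃u = ∇u · e₃`. Proof: the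
tree's `L⁶` bound on Tao patches under the one-direction hypothesis (`exists_lsix_le_of_oneDirection`, with Stein's
bound for the normalised pressure) keeps `limsup ‖u‖_{H¹}` finite (`limsup_eH1NormSq_lt_top_of_ltheta_bound_near`),
so Leray's continuation would make `u` `H¹`-regular on `(0, T]`, against `not_isH1RegularOn_Ioc`.
[cite: LemarieRieusset2016, Prop. 11.6 (PDF p. 357)] [cite: KukavicaZiane2007, Thm 1.1] -/
theorem not_memLqLp_deriv_direction {ν T : ℝ} (hν : 0 < ν) (hT : 0 < T)
    {u : ℝ → EuclideanSpace ℝ (Fin 3) → EuclideanSpace ℝ (Fin 3)} {p : ℝ → EuclideanSpace ℝ (Fin 3) → ℝ}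
    (hmax : IsMaximalSmoothSolution ν 0 u p T) (hLH : IsLerayHopfOn T ν 0 (u 0) u)
    {q r : ℝ≥0∞} (h2q : 2 ≤ q) (hq3 : q ≤ 3) (hqr : 2 / q + 3 / r = 2) :
    ¬ MemLqLp q r (fun t x => fderiv ℝ (u t) x (EuclideanSpace.single 2 (1 : ℝ))) (Ioo 0 T) := by
  intro hS
  obtain ⟨c, hc, hL2⟩ := tao2011_H1_local_almost_regular_holds
  obtain ⟨hr0, hrtop, hR1, hR2, hq0, hqtop, hqR⟩ := oneDirection_exponents h2q hq3 hqr
  -- Stein's constant at exponent `3r/(r-1)`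
  have hm1 : 1 < 3 * r.toReal / (r.toReal - 1) := by rw [lt_div_iff₀ (by linarith)]; linarith
  have h1m : 1 < ENNReal.ofReal (3 * r.toReal / (r.toReal - 1)) := by
    rw [← ENNReal.ofReal_one]; exact (ENNReal.ofReal_lt_ofReal_iff (by linarith)).2 hm1
  obtain ⟨CS, hCS⟩ := exists_eLpNorm_normalisedPressure_le_sq
    (p := ENNReal.ofReal (3 * r.toReal / (r.toReal - 1))) h1m ENNReal.ofReal_lt_top
  -- the weight
  have hbf : (EuclideanSpace.single (2 : Fin 3) (1 : ℝ)) = (EuclideanSpace.basisFun (Fin 3) ℝ 2) := by simp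
  rw [hbf] at hS
  obtain ⟨hA1, hLq⟩ := lintegral_ofReal_rpow_oneDirection_lt_top hq0 hqtop hr0 hrtop hS
  rw [hqR] at hA1
  refine not_isH1RegularOn_Ioc hν hT hmax hLH
    (leray_continuation_H1_holds ν T hν hT (u 0) u hLH fun α β hα hαβ hβ hregI => ?_)
  obtain ⟨t₀, ht₀m, hy₀⟩ := exists_mem_Ioo_lintegral_norm_rpow_lt_top hL2 hc hν hLH hα hαβ hβ
    hregI (θ := 6) (by norm_num)
  obtain ⟨K, hK, hbd⟩ := exists_lsix_le_of_oneDirection hL2 hc hν hLH hmax.1 hR1 hR2 hLq hCS hA1.ne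
    hα hβ hregI ht₀m hy₀
  exact limsup_eH1NormSq_lt_top_of_ltheta_bound_near hν hLH hα hαβ hβ hregI
    (θ := 6) (by norm_num) (δ := β - t₀) (sub_pos.2 ht₀m.2) hK
    fun t ht => hbd t ⟨by linarith [ht.1], ht.2⟩

/-- **L45′ ON EVERY TERMINAL WINDOW**: for every `t₀ ∈ [0, T)`, `∂₃u ∉ L^q(t₀, T; L^r)`.
[cite: LemarieRieusset2016, Prop. 11.6 (PDF p. 357)] -/
theorem not_memLqLp_deriv_direction_window {ν T : ℝ} (hν : 0 < ν)
    {u : ℝ → EuclideanSpace ℝ (Fin 3) → EuclideanSpace ℝ (Fin 3)} {p : ℝ → EuclideanSpace ℝ (Fin 3) → ℝ}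
    (hmax : IsMaximalSmoothSolution ν 0 u p T) (hLH : IsLerayHopfOn T ν 0 (u 0) u)
    {q r : ℝ≥0∞} (h2q : 2 ≤ q) (hq3 : q ≤ 3) (hqr : 2 / q + 3 / r = 2)
    {t₀ : ℝ} (ht₀ : t₀ ∈ Ico 0 T) :
    ¬ MemLqLp q r (fun t x => fderiv ℝ (u t) x (EuclideanSpace.single 2 (1 : ℝ))) (Ioo t₀ T) := by
  intro hS
  obtain ⟨s, hs, hLHs⟩ := hLH.exists_isLerayHopfOn_restart_Ioo hν.le ht₀.1 ht₀.2 le_rfl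
  have hs0 : 0 < s := ht₀.1.trans_lt hs.1
  have hTs : 0 < T - s := sub_pos.2 hs.2
  have hmax' : IsMaximalSmoothSolution ν 0 (fun t => u (t + s)) (fun t => p (t + s)) (T - s) :=
    hmax.translate_zero hs0 hs.2
  have hLH' : IsLerayHopfOn (T - s) ν 0 ((fun t => u (t + s)) 0) (fun t => u (t + s)) := by
    show IsLerayHopfOn (T - s) ν 0 (u (0 + s)) (fun t => u (t + s))
    rw [zero_add]
    exact hLHs
  have hS' : MemLqLp q r (fun t x => fderiv ℝ (u (t + s)) x (EuclideanSpace.single 2 (1 : ℝ)))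
      (Ioo 0 (T - s)) := by
    have h := hS.mono_set (Ioo_subset_Ioo hs.1.le le_rfl)
    rw [show Ioo s T = Ioo (0 + s) (T - s + s) by rw [zero_add, sub_add_cancel]] at h
    exact h.translate s
  exact not_memLqLp_deriv_direction hν hTs hmax' hLH' h2q hq3 hqr hS'

/-- **THE ANISOTROPY FACE, ASSEMBLED**: on every terminal window, no component gradient `∇u₃` lies in
`L^q_tL^r_x` with `2/q + 3/r = 3/2`, `2 ≤ q < ∞`, and no directional derivative `∂₃u` lies in `L^q_tL^r_x` with
`2/q + 3/r = 2`, `2 ≤ q ≤ 3`. [cite: LemarieRieusset2016, Props. 11.5–11.6] -/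
theorem anisotropy_face {ν T : ℝ} (hν : 0 < ν)
    {u : ℝ → EuclideanSpace ℝ (Fin 3) → EuclideanSpace ℝ (Fin 3)} {p : ℝ → EuclideanSpace ℝ (Fin 3) → ℝ}
    (hmax : IsMaximalSmoothSolution ν 0 u p T) (hLH : IsLerayHopfOn T ν 0 (u 0) u) :
    (∀ (q r : ℝ≥0∞), 2 ≤ q → q < ⊤ → 2 / q + 3 / r = 3 / 2 → ∀ t₀ ∈ Ico 0 T,
        ¬ MemLqLp q r (fun t x => fderiv ℝ (fun y => u t y 2) x) (Ioo t₀ T)) ∧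
      ∀ (q r : ℝ≥0∞), 2 ≤ q → q ≤ 3 → 2 / q + 3 / r = 2 → ∀ t₀ ∈ Ico 0 T,
        ¬ MemLqLp q r (fun t x => fderiv ℝ (u t) x (EuclideanSpace.single 2 (1 : ℝ))) (Ioo t₀ T) :=
  ⟨fun _ _ h2q hqtop hqr _ ht₀ => not_memLqLp_grad_component_window hν hmax hLH h2q hqtop hqr ht₀,
    fun _ _ h2q hq3 hqr _ ht₀ => not_memLqLp_deriv_direction_window hν hmax hLH h2q hq3 hqr ht₀⟩

end Summit.NavierStokesRegularity.FluidComputer.AnisotropyFace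

end
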